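import Literature.MathematicalPhysics.QuantumFieldTheory.Balaban1983to89.B8Ineq159PeriodizedTowerClass
import Literature.MathematicalPhysics.QuantumFieldTheory.Balaban1983to89.B8Ineq159TopCubeTowerSourceReads

/-!
# `Balaban1983to89.B8Ineq159PeriodizedTowerSourceReads` — [Balaban1985RegularSpaces] (1.146) p. 101, (1.38) p. 82, (1.131) p. 99, (1.7) p. 77, p. 77 («Ω_j = T_η»):
# the SOURCED reads over the periodised Sect.-F tower `Ωᴾ = periodize (fun _ ↦ P) (cubeFam true L a M ρ k)` — the transfer of the sourced Landau condition (1.146)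
# (multiplier half) at `(Ωᴾ₀ = T, Lam L Ωᴾ k)` to the sourceless (1.38) of a translate cube member for the field minus a divergence potential of the source, and
# the background class of a translate tower inside the class of `Ωᴾ`

statement-level skeleton of published theorems with citation tags; proofs where landed; nothing here is a claim about the
Yang–Mills mass gap

`[Balaban1985RegularSpaces]` ("B8", CMP **99** (1985) 75–102) (1.1) p. 76, (1.7) p. 77, (1.38) p. 82, (1.131) p. 99, (1.146) p. 101 («R(U₀)D^{η*}_{U₀}A = f, R(U₀)f = f»),
p. 98; [4] = `[Balaban1985BackgroundPropagators]` (3.19) p. 393, (3.23)–(3.25) p. 394; [B6] = `[Balaban1984PropagatorsII]` (2.1)–(2.3) p. 224; [B11] =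
`[Balaban1985Variational]` (3) p. 278.

CITATION HEADER (lean-in-tree rule).  Cell `pub-ymgap` (YM Track A, HUMAN RULING D-0062 ∕ D-0149), DAG node N05 = [B8], width seat `pub-ymgap-dag-n05-w3` (g5),
CLAIM-2 file (D1) — the SOURCED twin of file (A2) `B8Ineq159PeriodizedTowerClass` §2, for the sourced b9-socket of Proposition 3's frame (`SB9srcHP`, Theorem 8's
input) at the periodised Sect.-F tower.  WHY.  The sourced pointwise bound (this lineage's g4 `B8Ineq159TopCubeTowerSourcePoint`) cancels the source `f` of (1.146)
near a cube by a line-integral divergence potential `A″` (`D^{η*}_{U₀}A″ = f` on `□₀`) and runs the per-cube (1.59) for `𝟙_S(A′ − A″)`; over the periodised tower this is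
done translate by translate, and the one periodised-specific input is the transfer below (the other inputs — the potential, [B7] Prop. 5 at the translate's class bonds —
are this lineage's g4 lemmas at the single tower over `a + q•v`, whose background class follows from the class over `Ωᴾ` (§2)).

THE MATHEMATICS (kernel-checked).  §1 ★★ `isLandau138_cube_of_periodize_source`: if `Δ^η_{U₀}(D^{η*}_{U₀}A − f) = Q′(U₀)ᵀμ` on `T` with the restriction family
`Lam L Ωᴾ k`, `D^{η*}_{U₀}A″ = f` on `□₀(a + q•v)`, and `A′ = A − A″` on the bonds touching `□₀(a + q•v)`, then `A′` satisfies (1.38) in multiplier form at the translate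
member `(□₀(a + q•v), cubeLamS (a + q•v) … k)` — g4's `isLandau138_cube_of_univ_source` with the block-label locality of `Q′ᵀ` (`QprimeT_congr_fun`) and file (A1)'s
local agreement of the level sets in place of literal equalities.  §2 `inAk_translate_of_periodize`: `𝔄_k(Ωᴾ, α) ⊆ 𝔄_k((T, □₁(a + q•v), …), α)` (the translate tower's
domains lie in `Ωᴾ` level by level).

HONEST SCOPE.  Multiplier bookkeeping only: no estimate of [B8] ∕ [4] is proved here; the potential `A″` is NOT constructed here (g4 `exists_divPotential`); nothing of
Bałaban's asserted; count-neutral; N05 NOT discharged; one finite `𝕋⁴` programme at fixed `ε`, Bałaban as printed; the YM mass gap (Clay) is NOT proved by any of this —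
R4 closes the conditional finite-`𝕋⁴` rung `BalabanLadder.UV` only; nothing continuum ∕ ℝ⁴ ∕ OS.  No `sorry`, no `def`, no `instance`, no `notation`.
Unit `pub-ymgap-dag-n05-w3` (g5), 2026-08-28.
-/

noncomputable section

namespace Literature.MathematicalPhysics.QuantumFieldTheory.Balaban1983to89.B8Ineq159PeriodizedTowerSourceReads

open B7Prop1Explicit B7Prop2Explicit B7Prop1Local B7Eq78Linearization
open B8Ineq132 (covDerivFwd covDeriv BondTouches PlaqTouches InAk condAt_anti)
open B8Eq138LandauZd (IsLandau138 QT QprimeT covDivB covLap)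
open B8Eq131CubesAdmissible (cubeFam cubeFam_true_zero cubeFam_false_zero cubeFam_of_pos)
open B8Eq131Cubes (cube gs cube_anti)
open B8CubeMemberZd (cubeLamS cubeLamS_top mem_cubeLam_zero_iff)
open B8Ineq159CurvedCubeMemberLocalTower (QprimeT_congr_fun)
open B8TowerBondsPrinted (towerBondsP)
open B8Ineq159TopCubeTowerReads (add_e_mem_cube_zero covDivB_congr_fld covLap_congr_fld)
open B8Ineq159TopCubeTowerSourceReads (covDivB_sub_fld)
open B15LatticeCubeTorus (periodize)
open Literature.MathematicalPhysics.QuantumLattice (blockMap)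
open B8Ineq159PeriodizedTowerReads

-- `Site` alone would resolve to the torus sites of `Setup.lean`; re-export the `ℤ^d` sites of `B7Prop1Explicit`.
export B7Prop1Explicit (Site)

variable {d : ℕ} {𝔹 : Type*} [CStarAlgebra 𝔹]

/-! ## §1 The sourced Landau condition at the periodised tower ⟹ (1.38) at a translate cube member for `A′ = A − A″` -/

section Landau

variable {η : ℝ} {U₀ : Site d → Fin d → 𝔹ˣ}

/-- ★★ **THE SOURCED LANDAU CONDITION (1.146) OF THE PERIODISED TOWER IMPLIES A TRANSLATE CUBE MEMBER'S (1.38) FOR THE FIELD MINUS A DIVERGENCE POTENTIAL OF THE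
SOURCE.**  If `Δ^η_{U₀}(D^{η*}_{U₀}A − f) = Q′(U₀)ᵀμ` on `T` (the multiplier half of (1.146) at `Ωᴾ₀ = T`, restriction family `Lam L Ωᴾ k`), `D^{η*}_{U₀}A″ = f` on
`□₀(a + q•v)`, and `A′ = A − A″` on the bonds touching `□₀(a + q•v)`, then `A′` satisfies (1.38) in multiplier form at the translate member `{□_j(a + q•v)}_{j=0}^{k}`
(Dirichlet `□₀(a + q•v)`, `cubeLamS … k`): level-`0` multiplier free on `□₀ ∖ □₁`, `𝟙_{□₀}` invisible inside `□₁` (collar `ρ ≥ 1`) where `D^{η*}A′ = D^{η*}A − f` kills the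
source, level-`0` indicator of `Ωᴾ` vanishing on `□₁(a + q•v) ⊂ Ωᴾ₁`, and for `j ≥ 1` the transposes agree at the block labels of `x` by file (A1)'s local agreement.
[cite: Balaban1985RegularSpaces, (1.146) p.101, (1.38) p.82, (1.131) p.99, p.98, p.77 («Ω_j = T_η»); Balaban1985BackgroundPropagators, (3.19) p.393, (3.23)–(3.25) p.394] -/
theorem isLandau138_cube_of_periodize_source {L : ℕ} (hL : 1 ≤ L) (a : Site d) (M : ℕ) {ρ : ℕ} (hρ : L ≤ ρ) {k P : ℕ} {q : ℤ}
    (hq : (L : ℤ) ^ k * q = P) (hP : L ^ k * M + 2 * (ρ * gs L k) ≤ P) (hk : 1 ≤ k) (v : Site d)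
    {A A' A'' : Site d → Fin d → 𝔹} {f : Site d → 𝔹}
    (hagree : ∀ (y : Site d) (τ : Fin d), BondTouches (cube L (a + q • v) M ρ k 0) y τ → A' y τ = A y τ - A'' y τ)
    (hdiv : ∀ x, x ∈ cube L (a + q • v) M ρ k 0 → covDivB η U₀ A'' x = f x)
    (hLan : ∃ μ : ℕ → Site d → 𝔹, ∀ x, covLap η U₀ (fun z => covDivB η U₀ A z - f z) x =
      QT L k (B11Eq7Convention.Lam L (periodize (fun _ : Fin d => P) (cubeFam true L a M ρ k)) k) U₀ μ x) :
    IsLandau138 L k η (cubeFam false L (a + q • v) M ρ k 0) (cubeLamS L (a + q • v) M ρ k k) U₀ A' := by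
  classical
  have hρ1 : 1 ≤ ρ := hL.trans hρ
  obtain ⟨μ, hμ⟩ := hLan
  set tail : Site d → 𝔹 := fun x => ∑ j ∈ Finset.range k,
    QprimeT L U₀ (j + 1) ((cubeLamS L (a + q • v) M ρ k k (j + 1)).indicator (μ (j + 1))) x with htail
  set g' : Site d → 𝔹 := (cube L (a + q • v) M ρ k 0).indicator (covDivB η U₀ A') with hg'
  refine ⟨fun j x => if j = 0 then covLap η U₀ g' x - tail x else μ j x, fun x hx => ?_⟩
  rw [cubeFam_false_zero] at hx
  have hRHS : QT L k (cubeLamS L (a + q • v) M ρ k k) U₀ (fun j x => if j = 0 then covLap η U₀ g' x - tail x else μ j x) x =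
      (cubeLamS L (a + q • v) M ρ k k 0).indicator (fun x => covLap η U₀ g' x - tail x) x + tail x := by
    unfold QT
    rw [Finset.sum_range_succ']
    have h1 : ∀ j ∈ Finset.range k, QprimeT L U₀ (j + 1)
        ((cubeLamS L (a + q • v) M ρ k k (j + 1)).indicator
          ((fun (j : ℕ) (x : Site d) => if j = 0 then covLap η U₀ g' x - tail x else μ j x) (j + 1))) x =
        QprimeT L U₀ (j + 1) ((cubeLamS L (a + q • v) M ρ k k (j + 1)).indicator (μ (j + 1))) x := by
      intro j _
      have : (fun (x : Site d) => if j + 1 = 0 then covLap η U₀ g' x - tail x else μ (j + 1) x) = μ (j + 1) := by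
        funext y; simp
      simp only [this]
    rw [Finset.sum_congr rfl h1, add_comm]
    rfl
  rw [cubeFam_false_zero, hRHS]
  by_cases h1 : x ∈ cube L (a + q • v) M ρ k 1
  · have hx0 : x ∉ cubeLamS L (a + q • v) M ρ k k 0 := by
      rw [cubeLamS_top L _ M ρ (Nat.zero_le k), mem_cubeLam_zero_iff hL _ M ρ hk]; exact fun h => h.2 h1
    rw [Set.indicator_of_notMem hx0, zero_add]
    have hx00 : x ∈ cube L (a + q • v) M ρ k 0 := cube_anti (Nat.zero_le 1) hk h1
    have hP' : covLap η U₀ (fun z => covDivB η U₀ A z - f z) x = tail x := by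
      rw [hμ x]
      unfold QT
      rw [Finset.sum_range_succ']
      have h0 : (B11Eq7Convention.Lam L (periodize (fun _ : Fin d => P) (cubeFam true L a M ρ k)) k 0).indicator (μ 0) x = 0 :=
        Set.indicator_of_notMem (fun h => (mem_lam_periodize_zero_iff a M ρ hq hk x).1 h v h1) _
      have e0 : QprimeT L U₀ 0 ((B11Eq7Convention.Lam L (periodize (fun _ : Fin d => P) (cubeFam true L a M ρ k)) k 0).indicator (μ 0)) x =
          (B11Eq7Convention.Lam L (periodize (fun _ : Fin d => P) (cubeFam true L a M ρ k)) k 0).indicator (μ 0) x := rfl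
      rw [e0, h0, add_zero]
      refine Finset.sum_congr rfl fun j hj => ?_
      have hjk : j + 1 ≤ k := Nat.succ_le_of_lt (Finset.mem_range.mp hj)
      have hiff := mem_lam_periodize_iff_cubeLamS hL a M hρ hq hP hx00 (Nat.succ_pos j) hjk
      refine QprimeT_congr_fun U₀ (j + 1) x ?_
      by_cases hm : blockMap (L ^ (j + 1)) x ∈ B11Eq7Convention.Lam L (periodize (fun _ : Fin d => P) (cubeFam true L a M ρ k)) k (j + 1)
      · rw [Set.indicator_of_mem hm, Set.indicator_of_mem (hiff.1 hm)]
      · rw [Set.indicator_of_notMem hm, Set.indicator_of_notMem (fun h => hm (hiff.2 h))]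
    rw [← hP']
    -- on `□₀`: `𝟙_{□₀}D^{η*}A′ = D^{η*}A − D^{η*}A″ = D^{η*}A − f`
    have hdiv' : ∀ z, z ∈ cube L (a + q • v) M ρ k 0 → g' z = covDivB η U₀ A z - f z := by
      intro z hz
      rw [hg', Set.indicator_of_mem hz, ← hdiv z hz, ← covDivB_sub_fld]
      exact covDivB_congr_fld z (fun ν => hagree _ _ (Or.inr (by rw [sub_add_cancel]; exact hz))) fun ν => hagree _ _ (Or.inl hz)
    exact covLap_congr_fld x (hdiv' x hx00) (fun ν => hdiv' _ (add_e_mem_cube_zero hρ1 hk h1 ν).1)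
      fun ν => hdiv' _ (add_e_mem_cube_zero hρ1 hk h1 ν).2
  · have hx0 : x ∈ cubeLamS L (a + q • v) M ρ k k 0 := by
      rw [cubeLamS_top L _ M ρ (Nat.zero_le k), mem_cubeLam_zero_iff hL _ M ρ hk]; exact ⟨hx, h1⟩
    rw [Set.indicator_of_mem hx0, sub_add_cancel]

end Landau

/-! ## §2 The background class of a translate tower inside the class of the periodised tower -/

section Backgrounds

variable {η α : ℝ} {U₀ : Site d → Fin d → 𝔹ˣ}

omit [CStarAlgebra 𝔹] in
/-- **`𝔄_k(Ωᴾ, α) ⊆ 𝔄_k((T, □₁(a + q•v), …, □_k(a + q•v)), α)`**: (1.7) on the plaquettes ∕ bonds touching `Ωᴾ_j` implies (1.7) on those touching the translate's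
`□_j(a + q•v) ⊆ Ωᴾ_j` (level `0`: `T = T`). [cite: Balaban1985RegularSpaces, (1.7) p.77, (1.131) p.99; Balaban1984PropagatorsII, (2.1) p.224] -/
theorem inAk_translate_of_periodize [NormedRing 𝔹] [NormedAlgebra ℂ 𝔹] {L : ℕ} (a : Site d) (M ρ k : ℕ) {P : ℕ} {q : ℤ}
    (hq : (L : ℤ) ^ k * q = P) (v : Site d) {U₀ : Site d → Fin d → 𝔹ˣ}
    (h : InAk L k η α (periodize (fun _ : Fin d => P) (cubeFam true L a M ρ k)) U₀) :
    InAk L k η α (cubeFam true L (a + q • v) M ρ k) U₀ :=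
  fun j hj => condAt_anti (cubeFam_translate_subset_periodize a M ρ k hq v j) (h j hj)

end Backgrounds

end Literature.MathematicalPhysics.QuantumFieldTheory.Balaban1983to89.B8Ineq159PeriodizedTowerSourceReads

end
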